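import Literature.AnabelianGeometry.EtaleTheta.ThetaCohomology
import HarnessLib

/-!
# [EtTh] §1, Prop. 1.4 (iii) for THE class: the single-class value law (B4) of the K2 sub-DAG, reduced
# to the value law of ONE reference theta class, and t1's `Prop14iiiValues` as its corollary

S. Mochizuki, *The étale theta function …*, Publ. RIMS 45 (2009), §1, Prop. 1.4 (iii), PRIMS p.248
(«if … `y ∈ Ÿ(L)` is a non-cuspidal point, then the restricted classes `O^×_K̈ · η̈^Θ|_y … lie in
`L^× ⊆ (L^×)^∧` and are equal to the values `O^×_K̈ · Θ̈(y)`») and Def. 1.9 (ii), p.255 («[cf. the value at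
`√−1` of the series representation of `Θ̈`]») [cite: MochizukiEtTh2009, Prop 1.4 (iii) p.22].
PROOF-ONLY companion (no `def`) of `ThetaCohomology.lean` (seat abc-iut-L2-t1: `NonCuspidalPoint`,
`evalAt`, `evalAt_kum`, `Prop14iiiValues`), written for plan/GAP-LEDGER.md row **G-L2t6g4-2** = the
binders `val`/`hval`/`heval` of `MuTwoSetting.standardValuesFormulaSigned_of_dictionary`
(`Discharge/Sec1StandardValuesModel.lean`, p418439, abc-iut-L2-t6): «the value at `τ_a` of THE class `x`
is `c · Θ̈(Ü(τ_a))` for ONE constant `c` independent of `a`».  Cell sub-DAG plan/L2/SUBDAG-EtTh-Thm110.md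
(K2, holder abc-iut-w5-d140), row T110.i.r8 / (B4); ROW assigned by abc-iut-L2-lead 2026-08-26T03:09:26Z.

WHY A BINDER REMAINS.  t1's named fact `Prop14iiiValues` types the printed sentence for the TORSOR
`O^×_K̈ · η̈^Θ`: at each point `y` the value of a theta class is `a_y · Θ̈(Ü(y))` with a unit `a_y` that
may depend on `y` — too weak for (B4), which needs the SAME constant at every `τ_a`.  The interface
carries `NonCuspidalPoint.evalAt` as free data per point, pinned only on constants (`evalAt_kum`); the
printed reason for constancy — `x` is the Kummer class of ONE function `c·Θ̈`, and the Kummer class of a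
function evaluates at `y` to the value of the function — has no carrier (the Kummer map of FUNCTIONS is
[EtTh] §5).  So the irreducible input is the value law for ONE REFERENCE CLASS `κ₀` of the torsor at
every non-cuspidal point (hypothesis `hκ₀`, never asserted).  From it, by `evalAt_kum` and the
multiplicativity of `res`/`evalAt`, THIS FILE PROVES:
* `exists_const_value_law` — for EVERY theta class `x` there is ONE `c ∈ ℚ̄_p` (a unit of `K̈`, the
  ratio `x/κ₀`) with `evalAt_y(x|_y) = toKddHat(val)`, `↑val = c · Θ̈(Ü(y))` at EVERY non-cuspidal `y`;
* `exists_val_family` — the binders `val`/`hval`/`heval` of p418439 VERBATIM for any family of points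
  `τ_ : ι → NonCuspidalPoint` (in particular `ι = ℤ`), i.e. **G-L2t6g4-2 ⟸ the reference-class law**;
* `prop14iiiValues_of_referenceClass` — t1's `Prop14iiiValues` (FACT-LIST F-0590) is a COROLLARY of the
  same single binder (so (B4) is the sharper of the two typings of the one printed sentence).
HONEST FRAMING: typed ≠ proved for [EtTh]; the reference-class law is a hypothesis here (to be
discharged at the Kummer-of-functions model, [EtTh] §5 / abc-iut-L2-t3, or typed by abc-iut-L2-t1 as a
field of the point interface); nothing here bears on the disputed [IUTchIII] Cor. 3.12.
v2 (junk-robust shapes): `NonCuspidalPoint` is FREE DATA per point (decomposition group, coordinate and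
evaluation map are independent fields), so a law quantified over ALL abstract points is stronger than
print and could never be supplied by a model; `exists_val_family_of_lawOn` asks the reference-class law
only ON THE FAMILY OF POINTS USED (exactly p418439's `τ_`), and `lawOn_of_res_eq` derives it from the
`evalAt`-free printed form «`κ₀|_{D_y}` = the class of the constant `Θ̈(Ü(y))` restricted to `D_y`»
(`evalAt_kum`).
-/

noncomputable section

namespace Literature.AnabelianGeometry.EtaleTheta

open Literature.AnabelianGeometry.SemiGraphs

namespace ThetaSetting

variable {p : ℕ} [Fact p.Prime] {D : ThetaSetting p}

namespace EtaleThetaData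

variable (E : D.EtaleThetaData)

/-- Membership in `O^×_K̈ ⊆ H¹(Π^tp_Ÿ, Δ_Θ)` (`kumUnitsYdd`) unfolded: the inflated Kummer class of a unit.
[cite: MochizukiEtTh2009, Prop 1.3 p.21] -/
theorem mem_kumUnitsYdd_iff_exists_unit (k : D.H1 D.GtpYdd) :
    k ∈ E.kumUnitsYdd ↔
      ∃ u ∈ D.unitsOKdd, k = D.inflTheta D.GtpYdd (E.kumYdd (E.toKddHat u)) := by
  constructor
  · rintro ⟨_, ⟨u, hu, rfl⟩, rfl⟩
    exact ⟨u, hu, rfl⟩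
  · rintro ⟨u, hu, rfl⟩
    exact ⟨E.toKddHat u, ⟨u, hu, rfl⟩, rfl⟩

/-- Two theta classes differ by the Kummer class of a unit: if `κ₀, x ∈ O^×_K̈ · η̈^Θ` then
`x = infl κ(u) · κ₀` for some `u ∈ O^×_K̈` (the torsor structure of Prop. 1.3).
[cite: MochizukiEtTh2009, Prop 1.3 p.21] -/
theorem exists_unit_mul_of_mem_thetaClasses {κ₀ x : D.H1 D.GtpYdd} (hκ₀ : κ₀ ∈ E.thetaClasses)
    (hx : x ∈ E.thetaClasses) :
    ∃ u ∈ D.unitsOKdd, x = D.inflTheta D.GtpYdd (E.kumYdd (E.toKddHat u)) * κ₀ := by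
  obtain ⟨k₀, hk₀, rfl⟩ := hκ₀
  obtain ⟨k, hk, rfl⟩ := hx
  have hmem : k * k₀⁻¹ ∈ E.kumUnitsYdd := mul_mem hk (inv_mem hk₀)
  obtain ⟨u, hu, hu'⟩ := (E.mem_kumUnitsYdd_iff_exists_unit _).1 hmem
  exact ⟨u, hu, by rw [← hu', mul_assoc, inv_mul_cancel_left]⟩

end EtaleThetaData

namespace NonCuspidalPoint

variable {E : D.KummerData} (y : NonCuspidalPoint E)

/-- Evaluation at `y` of a translate by the Kummer class of a constant: `(infl κ(c) · x)|_y ↦ c · x(y)`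
(`evalAt`, `res` are homomorphisms; `evalAt_kum`). [cite: MochizukiEtTh2009, Prop 1.4 (iii) p.22] -/
theorem evalAt_res_kum_mul (c : E.KddHat) (x : D.H1 D.GtpYdd) :
    y.evalAt (ContH1.res D.toTheta D.DeltaTheta y.Dpt_le
        (D.inflTheta D.GtpYdd (E.kumYdd c) * x)) =
      c * y.evalAt (ContH1.res D.toTheta D.DeltaTheta y.Dpt_le x) := by
  rw [map_mul, map_mul, y.evalAt_kum]

end NonCuspidalPoint

/-! ### (B4) for every theta class from the value law of ONE reference class -/

namespace EtaleThetaData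

variable (E : D.EtaleThetaData)

/-- Coercion `K̈^× → ℚ̄_p` is multiplicative (bookkeeping). [cite: MochizukiEtTh2009, §1 p.17] -/
theorem coe_Kdd_units_mul (v w : (↥D.Kdd)ˣ) :
    (((v * w : (↥D.Kdd)ˣ) : D.Kdd) : PadicAlgCl p) =
      ((v : D.Kdd) : PadicAlgCl p) * ((w : D.Kdd) : PadicAlgCl p) := by
  rw [Units.val_mul]; rfl

/-- **Prop. 1.4 (iii) for THE class, from the reference class.**  Hypothesis `hκ₀` (the one
interface-invisible sentence): a REFERENCE theta class `κ₀ ∈ O^×_K̈ · η̈^Θ` whose value at every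
non-cuspidal `K̈`-point `y` is EXACTLY the series value, `evalAt_y(κ₀|_y) = Θ̈(Ü(y)) ∈ K̈^×` (the Kummer
class of the function `Θ̈` evaluates to the values of `Θ̈`).  Conclusion: EVERY theta class `x` has ONE
constant `c` — a unit of `K̈`, the same at all points — with `evalAt_y(x|_y) = c · Θ̈(Ü(y))`.
[cite: MochizukiEtTh2009, Prop 1.4 (iii) p.22] -/
theorem exists_const_value_law {κ₀ : D.H1 D.GtpYdd} (hκ₀mem : κ₀ ∈ E.thetaClasses)
    (hκ₀ : ∀ y : NonCuspidalPoint E.toKummerData, ∃ v : (↥D.Kdd)ˣ,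
      ((v : D.Kdd) : PadicAlgCl p) = thetaDdot D.qdd ((y.coord : D.Kdd) : PadicAlgCl p) ∧
      y.evalAt (ContH1.res D.toTheta D.DeltaTheta y.Dpt_le κ₀) = E.toKddHat v)
    {x : D.H1 D.GtpYdd} (hx : x ∈ E.thetaClasses) :
    ∃ u ∈ D.unitsOKdd, ∀ y : NonCuspidalPoint E.toKummerData, ∃ v : (↥D.Kdd)ˣ,
      ((v : D.Kdd) : PadicAlgCl p) =
          ((u : D.Kdd) : PadicAlgCl p) * thetaDdot D.qdd ((y.coord : D.Kdd) : PadicAlgCl p) ∧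
      y.evalAt (ContH1.res D.toTheta D.DeltaTheta y.Dpt_le x) = E.toKddHat v := by
  obtain ⟨u, hu, rfl⟩ := E.exists_unit_mul_of_mem_thetaClasses hκ₀mem hx
  refine ⟨u, hu, fun y => ?_⟩
  obtain ⟨v, hv, hyv⟩ := hκ₀ y
  refine ⟨u * v, by rw [coe_Kdd_units_mul, hv], ?_⟩
  rw [y.evalAt_res_kum_mul, hyv, map_mul]

/-- **G-L2t6g4-2 ⟸ the reference-class law — the binders `val`/`hval`/`heval` of
`MuTwoSetting.standardValuesFormulaSigned_of_dictionary` (p418439) VERBATIM**, for any family of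
non-cuspidal points `τ_ : ι → NonCuspidalPoint` (there `ι = ℤ`, `τ_ a` the point over `τ` with
`Ü(τ_a) = (s q̈)^a √−1`) and any theta class `x`: one constant `c ∈ ℚ̄_p` and values `val i ∈ K̈^×` with
`↑(val i) = c · Θ̈(Ü(τ_ i))` and `evalAt_{τ_ i}(x|_{τ_ i}) = toKddHat (val i)`.
[cite: MochizukiEtTh2009, Def 1.9 (ii) p.29] -/
theorem exists_val_family {κ₀ : D.H1 D.GtpYdd} (hκ₀mem : κ₀ ∈ E.thetaClasses)
    (hκ₀ : ∀ y : NonCuspidalPoint E.toKummerData, ∃ v : (↥D.Kdd)ˣ,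
      ((v : D.Kdd) : PadicAlgCl p) = thetaDdot D.qdd ((y.coord : D.Kdd) : PadicAlgCl p) ∧
      y.evalAt (ContH1.res D.toTheta D.DeltaTheta y.Dpt_le κ₀) = E.toKddHat v)
    {x : D.H1 D.GtpYdd} (hx : x ∈ E.thetaClasses) {ι : Type*}
    (τ_ : ι → NonCuspidalPoint E.toKummerData) :
    ∃ (c : PadicAlgCl p) (val : ι → (↥D.Kdd)ˣ),
      (∀ i, ((val i : D.Kdd) : PadicAlgCl p) =
        c * thetaDdot D.qdd (((τ_ i).coord : D.Kdd) : PadicAlgCl p)) ∧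
      (∀ i, (τ_ i).evalAt (ContH1.res D.toTheta D.DeltaTheta (τ_ i).Dpt_le x) =
        E.toKddHat (val i)) ∧
      ‖c‖ = 1 := by
  obtain ⟨u, hu, h⟩ := E.exists_const_value_law hκ₀mem hκ₀ hx
  choose val hval heval using fun i => h (τ_ i)
  exact ⟨((u : D.Kdd) : PadicAlgCl p), val, hval, heval, hu⟩

/-- **t1's `Prop14iiiValues` (FACT-LIST F-0590) is a COROLLARY of the reference-class law**: at each
point the value of any theta class is a unit (the constant `u`, here even independent of the point)
times `Θ̈(Ü(y))`. [cite: MochizukiEtTh2009, Prop 1.4 (iii) p.22] -/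
theorem prop14iiiValues_of_referenceClass {κ₀ : D.H1 D.GtpYdd} (hκ₀mem : κ₀ ∈ E.thetaClasses)
    (hκ₀ : ∀ y : NonCuspidalPoint E.toKummerData, ∃ v : (↥D.Kdd)ˣ,
      ((v : D.Kdd) : PadicAlgCl p) = thetaDdot D.qdd ((y.coord : D.Kdd) : PadicAlgCl p) ∧
      y.evalAt (ContH1.res D.toTheta D.DeltaTheta y.Dpt_le κ₀) = E.toKddHat v) :
    Prop14iiiValues E := by
  intro y x hx
  obtain ⟨u, hu, rfl⟩ := E.exists_unit_mul_of_mem_thetaClasses hκ₀mem hx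
  obtain ⟨v, hv, hyv⟩ := hκ₀ y
  exact ⟨u, hu, v, hv, by rw [y.evalAt_res_kum_mul, hyv, map_mul]⟩

/-- Conversely, the reference-class law for `κ₀` is the instance `x := κ₀`, `a_y := 1` of the SHARPENED
per-class form; recorded as the trivial direction so that consumers can cite either shape.
[cite: MochizukiEtTh2009, Prop 1.4 (iii) p.22] -/
theorem referenceClass_of_const_value_law {κ₀ : D.H1 D.GtpYdd}
    (h : ∃ u ∈ D.unitsOKdd, ((u : D.Kdd) : PadicAlgCl p) = 1 ∧
      ∀ y : NonCuspidalPoint E.toKummerData, ∃ v : (↥D.Kdd)ˣ,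
        ((v : D.Kdd) : PadicAlgCl p) =
            ((u : D.Kdd) : PadicAlgCl p) * thetaDdot D.qdd ((y.coord : D.Kdd) : PadicAlgCl p) ∧
        y.evalAt (ContH1.res D.toTheta D.DeltaTheta y.Dpt_le κ₀) = E.toKddHat v) :
    ∀ y : NonCuspidalPoint E.toKummerData, ∃ v : (↥D.Kdd)ˣ,
      ((v : D.Kdd) : PadicAlgCl p) = thetaDdot D.qdd ((y.coord : D.Kdd) : PadicAlgCl p) ∧
      y.evalAt (ContH1.res D.toTheta D.DeltaTheta y.Dpt_le κ₀) = E.toKddHat v := by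
  obtain ⟨u, -, hu1, h⟩ := h
  intro y
  obtain ⟨v, hv, hyv⟩ := h y
  exact ⟨v, by rw [hv, hu1, one_mul], hyv⟩

/-! ### v2: junk-robust shapes — the law only on the points used, and its `evalAt`-free form -/

/-- **The reference-class law ON A FAMILY from its `evalAt`-free printed form**: if for each point `τ_ i`
the restriction `κ₀|_{D_{τ_i}}` equals the restriction of the (inflated) Kummer class of the constant
`Θ̈(Ü(τ_i)) ∈ K̈^×` («the restricted classes … are equal to the values», p.248), then `κ₀` evaluates at
`τ_ i` to `Θ̈(Ü(τ_i))` (`evalAt_kum`). [cite: MochizukiEtTh2009, Prop 1.4 (iii) p.22] -/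
theorem lawOn_of_res_eq {κ₀ : D.H1 D.GtpYdd} {ι : Type*}
    (τ_ : ι → NonCuspidalPoint E.toKummerData)
    (h : ∀ i, ∃ v : (↥D.Kdd)ˣ,
      ((v : D.Kdd) : PadicAlgCl p) = thetaDdot D.qdd (((τ_ i).coord : D.Kdd) : PadicAlgCl p) ∧
      ContH1.res D.toTheta D.DeltaTheta (τ_ i).Dpt_le κ₀ =
        ContH1.res D.toTheta D.DeltaTheta (τ_ i).Dpt_le
          (D.inflTheta D.GtpYdd (E.kumYdd (E.toKddHat v)))) :
    ∀ i, ∃ v : (↥D.Kdd)ˣ,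
      ((v : D.Kdd) : PadicAlgCl p) = thetaDdot D.qdd (((τ_ i).coord : D.Kdd) : PadicAlgCl p) ∧
      (τ_ i).evalAt (ContH1.res D.toTheta D.DeltaTheta (τ_ i).Dpt_le κ₀) = E.toKddHat v := by
  intro i
  obtain ⟨v, hv, hres⟩ := h i
  exact ⟨v, hv, by rw [hres, (τ_ i).evalAt_kum]⟩

/-- **(B4) on a GIVEN family of points from the reference-class law ON THAT FAMILY** — the binders
`val`/`hval`/`heval` of p418439 for the family `τ_` and any theta class `x`, from `hκ₀` at the points
`τ_ i` only: one constant `c` (a unit, `‖c‖ = 1`, the ratio `x/κ₀`) and values `val i` with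
`↑(val i) = c · Θ̈(Ü(τ_i))`, `evalAt_{τ_i}(x|_{τ_i}) = toKddHat (val i)`.  This is the shape a model can
supply (G-L2t6g4-2, junk-robust). [cite: MochizukiEtTh2009, Def 1.9 (ii) p.29] -/
theorem exists_val_family_of_lawOn {κ₀ : D.H1 D.GtpYdd} (hκ₀mem : κ₀ ∈ E.thetaClasses) {ι : Type*}
    (τ_ : ι → NonCuspidalPoint E.toKummerData)
    (hκ₀ : ∀ i, ∃ v : (↥D.Kdd)ˣ,
      ((v : D.Kdd) : PadicAlgCl p) = thetaDdot D.qdd (((τ_ i).coord : D.Kdd) : PadicAlgCl p) ∧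
      (τ_ i).evalAt (ContH1.res D.toTheta D.DeltaTheta (τ_ i).Dpt_le κ₀) = E.toKddHat v)
    {x : D.H1 D.GtpYdd} (hx : x ∈ E.thetaClasses) :
    ∃ (c : PadicAlgCl p) (val : ι → (↥D.Kdd)ˣ),
      (∀ i, ((val i : D.Kdd) : PadicAlgCl p) =
        c * thetaDdot D.qdd (((τ_ i).coord : D.Kdd) : PadicAlgCl p)) ∧
      (∀ i, (τ_ i).evalAt (ContH1.res D.toTheta D.DeltaTheta (τ_ i).Dpt_le x) =
        E.toKddHat (val i)) ∧
      ‖c‖ = 1 := by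
  obtain ⟨u, hu, rfl⟩ := E.exists_unit_mul_of_mem_thetaClasses hκ₀mem hx
  choose v hv heval using hκ₀
  refine ⟨((u : D.Kdd) : PadicAlgCl p), fun i => u * v i, fun i => ?_, fun i => ?_, hu⟩
  · rw [coe_Kdd_units_mul, hv i]
  · rw [(τ_ i).evalAt_res_kum_mul, heval i, map_mul]

/-- The two-family variant used by `standardValuesInvSymm_of_dictionary` (points over `τ` AND over `τ⁻¹`,
ONE constant `c` for both): apply `exists_val_family_of_lawOn` to the combined family on `ι ⊕ ι'`.
[cite: MochizukiEtTh2009, Def 1.9 (ii) p.29] -/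
theorem exists_val_families_of_lawOn {κ₀ : D.H1 D.GtpYdd} (hκ₀mem : κ₀ ∈ E.thetaClasses)
    {ι ι' : Type*} (τ_ : ι → NonCuspidalPoint E.toKummerData)
    (τ'_ : ι' → NonCuspidalPoint E.toKummerData)
    (hκ₀ : ∀ i, ∃ v : (↥D.Kdd)ˣ,
      ((v : D.Kdd) : PadicAlgCl p) = thetaDdot D.qdd (((τ_ i).coord : D.Kdd) : PadicAlgCl p) ∧
      (τ_ i).evalAt (ContH1.res D.toTheta D.DeltaTheta (τ_ i).Dpt_le κ₀) = E.toKddHat v)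
    (hκ₀' : ∀ i, ∃ v : (↥D.Kdd)ˣ,
      ((v : D.Kdd) : PadicAlgCl p) = thetaDdot D.qdd (((τ'_ i).coord : D.Kdd) : PadicAlgCl p) ∧
      (τ'_ i).evalAt (ContH1.res D.toTheta D.DeltaTheta (τ'_ i).Dpt_le κ₀) = E.toKddHat v)
    {x : D.H1 D.GtpYdd} (hx : x ∈ E.thetaClasses) :
    ∃ (c : PadicAlgCl p) (val : ι → (↥D.Kdd)ˣ) (val' : ι' → (↥D.Kdd)ˣ),
      (∀ i, ((val i : D.Kdd) : PadicAlgCl p) =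
        c * thetaDdot D.qdd (((τ_ i).coord : D.Kdd) : PadicAlgCl p)) ∧
      (∀ i, ((val' i : D.Kdd) : PadicAlgCl p) =
        c * thetaDdot D.qdd (((τ'_ i).coord : D.Kdd) : PadicAlgCl p)) ∧
      (∀ i, (τ_ i).evalAt (ContH1.res D.toTheta D.DeltaTheta (τ_ i).Dpt_le x) =
        E.toKddHat (val i)) ∧
      (∀ i, (τ'_ i).evalAt (ContH1.res D.toTheta D.DeltaTheta (τ'_ i).Dpt_le x) =
        E.toKddHat (val' i)) ∧
      ‖c‖ = 1 := by
  have hsum : ∀ j : ι ⊕ ι', ∃ v : (↥D.Kdd)ˣ,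
      ((v : D.Kdd) : PadicAlgCl p) =
          thetaDdot D.qdd (((Sum.elim τ_ τ'_ j).coord : D.Kdd) : PadicAlgCl p) ∧
      (Sum.elim τ_ τ'_ j).evalAt
          (ContH1.res D.toTheta D.DeltaTheta (Sum.elim τ_ τ'_ j).Dpt_le κ₀) = E.toKddHat v := by
    rintro (i | i)
    · exact hκ₀ i
    · exact hκ₀' i
  obtain ⟨c, val, hval, heval, hc⟩ := E.exists_val_family_of_lawOn hκ₀mem (Sum.elim τ_ τ'_) hsum hx
  exact ⟨c, fun i => val (Sum.inl i), fun i => val (Sum.inr i), fun i => hval (Sum.inl i),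
    fun i => hval (Sum.inr i), fun i => heval (Sum.inl i), fun i => heval (Sum.inr i), hc⟩


end EtaleThetaData

end ThetaSetting

end Literature.AnabelianGeometry.EtaleTheta

end
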